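import Summits.CriticalPhenomena.CardyFormulaZ2.Theses.CardyAnchoredRigidity
import Summits.CriticalPhenomena.CardyFormulaZ2.Theses.CardyLocalRigidity
import Summits.CriticalPhenomena.CardyFormulaZ2.Theorems.CardyAnchoredRigidityClusterSetConnected
import Summits.CriticalPhenomena.CardyFormulaZ2.Theorems.CardyTensorRGPolyominoGaussianLawStubScalingIdentity
import Literature.Probability.RandomPlanarGeometry.ZoomFlow
import Literature.Probability.RandomPlanarGeometry.ImageUnivalent
import Literature.Probability.RandomPlanarGeometry.ConformalRectangleProofs
import HarnessLib

/-!
# Crux `CardyShadowIsolated` (stmt-CriticalPhenomena-5767), line `dilation-dynamics`: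
# the two provable stubs PROVED and the split glue
# `CardyIsolatedInvariant → CardyUnstableTrivial → CardyStableTrivial → CardyShadowIsolated`

Strategist's candidate Theorems file (planner seats cannot write `Theorems/`; a prover can land this
file verbatim with `--supports stmt-CriticalPhenomena-5767`: it proves the REGISTERED stubs
`stub_dilationFlow` and `stub_fixedPointCriterion` of `Cruxes/CardyShadowIsolated/Lines/dilation_dynamics.lean`
by name and signature, sorry-free).

Contents.
* §A  the dilation flow on the cluster set `Λ'` (stub A): exact scale covariance
  (`stub_scalingIdentity`), invariance of `Λ'`, group law (`MarkedDomain.map_map/map_refl`), joint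
  continuity from `ClusterSetConnected.scaleContinuity` (equicontinuity of cluster points along
  dilations) — `stub_dilationFlow`.
* §B  the fixed-point criterion of topological dynamics (stub B, Ura–Kimura form): in a compact
  connected T₂ space with a real flow, a fixed point that is an isolated invariant set with trivial
  stable and unstable sets is the whole space — `stub_fixedPointCriterion`.
* §C  the SPLIT of the crux into three sub-cruxes stated over tree declarations only
  (`CardyIsolatedInvariant`, `CardyUnstableTrivial`, `CardyStableTrivial`, one-line bodies =
  `children.json` of the strategist folder) and the sorry-free glue
  `CardyShadowIsolated_of_subs : CardyIsolatedInvariant → CardyUnstableTrivial → CardyStableTrivial →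
  …Theses.CardyAnchoredRigidity.CardyShadowIsolated` (and `_local` for the CardyLocalRigidity decl),
  via compactness + connectedness (`clusterSetConnected_anchored`) of `Λ'`, the flow of §A with the
  Cardy shadow as fixed point (`IsUniformizing.image_data`) and §B on the subtype `↥Λ'`.

No sorry, no named fact; axioms propext / Classical.choice / Quot.sound.
-/

noncomputable section

namespace Summit.CriticalPhenomena.CardyFormulaZ2.Theorems.CardyShadowIsolated.DilationDynamics

open Set Filter Topology
open Literature.Probability.RandomPlanarGeometry Literature.Probability.Percolation

/-! ## §A The dilation flow on `Λ'` -/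
/-! ### Objects (verbatim from the line file) -/

/-- The cluster set `Λ'` at `0⁺` of the crossing-function path (product topology); literally the
set of the crux / of `ClusterSetConnected`. [folklore] -/
def clusterSet : Set (ConformalRectangle → ℝ) :=
  {g | MapClusterPt g (nhdsWithin (0 : ℝ) (Set.Ioi 0))
    (fun (δ : ℝ) (R : ConformalRectangle) => bondDomainCrossingProb R δ)}

/-- `e^s ≠ 0` in `ℂ`. [folklore] -/
theorem exp_ofReal_ne_zero (s : ℝ) : ((Real.exp s : ℝ) : ℂ) ≠ 0 :=
  Complex.ofReal_ne_zero.2 (Real.exp_pos s).ne'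

/-- The dilation `z ↦ e^s z` of the plane, in log-scale parametrisation `s ∈ ℝ`. [folklore] -/
def dilation (s : ℝ) : ℂ ≃ₜ ℂ :=
  Homeomorph.mulLeft₀ ((Real.exp s : ℝ) : ℂ) (exp_ofReal_ne_zero s)

/-- Pointwise formula for `dilation`. [folklore] -/
@[simp] theorem dilation_apply (s : ℝ) (z : ℂ) : dilation s z = ((Real.exp s : ℝ) : ℂ) * z := rfl

/-- The coercion of `dilation s` is multiplication by `e^s`. [folklore] -/
theorem coe_dilation (s : ℝ) : (⇑(dilation s) : ℂ → ℂ) = fun z : ℂ => ((Real.exp s : ℝ) : ℂ) * z :=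
  rfl

/-- The scale action of log-scale `s` on crossing functions: evaluate on the `e^s`-dilate.
[cite: SchrammSmirnov2011, §1] -/
def scaleAct (s : ℝ) (g : ConformalRectangle → ℝ) : ConformalRectangle → ℝ :=
  fun R => g (R.map (dilation s))

/-! ### The group law of the dilations on marked domains -/

/-- `dilation 0` is the identity. [folklore] -/
theorem dilation_zero : dilation 0 = Homeomorph.refl ℂ :=
  Homeomorph.ext fun z => by simp [dilation_apply]

/-- `dilation s` followed by `dilation t` is `dilation (t + s)` (`e^t (e^s z) = e^{t+s} z`). [folklore] -/
theorem dilation_trans (s t : ℝ) : (dilation s).trans (dilation t) = dilation (t + s) :=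
  Homeomorph.ext fun z => by
    simp only [Homeomorph.trans_apply, dilation_apply, Real.exp_add, Complex.ofReal_mul]
    ring

/-- Dilating a marked domain by `e^0` does nothing. [folklore] -/
theorem map_dilation_zero (R : ConformalRectangle) : R.map (dilation 0) = R := by
  rw [dilation_zero, MarkedDomain.map_refl]

/-- Dilating by `e^s` and then by `e^t` is dilating by `e^{t+s}`. [folklore] -/
theorem map_dilation_map_dilation (R : ConformalRectangle) (s t : ℝ) :
    (R.map (dilation s)).map (dilation t) = R.map (dilation (t + s)) := by
  rw [MarkedDomain.map_map, dilation_trans]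

/-- The scale action at `0` is the identity. [folklore] -/
theorem scaleAct_zero (g : ConformalRectangle → ℝ) : scaleAct 0 g = g := by
  funext R
  simp only [scaleAct, map_dilation_zero]

/-- The scale action is an action: `scaleAct (s + t) = scaleAct s ∘ scaleAct t`. [folklore] -/
theorem scaleAct_add (s t : ℝ) (g : ConformalRectangle → ℝ) :
    scaleAct (s + t) g = scaleAct s (scaleAct t g) := by
  funext R
  simp only [scaleAct, map_dilation_map_dilation, add_comm t s]

/-! ### Exact covariance and invariance of `Λ'` -/

/-- **Exact scale covariance** of the `ℤ²` crossing probabilities of conformal rectangles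
(tree `stub_scalingIdentity`). [folklore] -/
theorem bondDomainCrossingProb_map_dilation (R : ConformalRectangle) (s δ : ℝ) :
    bondDomainCrossingProb (R.map (dilation s)) δ = bondDomainCrossingProb R (Real.exp (-s) * δ) := by
  have key := Summit.CriticalPhenomena.CardyFormulaZ2.Cruxes.PolyominoGaussianLaw.Birth.stub_scalingIdentity
    R.carrier (R.arc 0) (R.arc 2) (Real.exp (-s) * δ) (Real.exp s) (Real.exp_pos s)
  have hmul : Real.exp s * (Real.exp (-s) * δ) = δ := by
    rw [← mul_assoc, ← Real.exp_add, add_neg_cancel, Real.exp_zero, one_mul]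
  rw [hmul] at key
  unfold bondDomainCrossingProb
  rw [MarkedDomain.carrier_map, MarkedDomain.arc_map, MarkedDomain.arc_map, coe_dilation]
  exact key

/-- The scale action by `s` is continuous on the product space. [folklore] -/
theorem continuous_scaleAct (s : ℝ) : Continuous (scaleAct s) :=
  continuous_pi fun R => continuous_apply (R.map (dilation s))

/-- **`Λ'` is invariant under every dilation.** [cite: SchrammSmirnov2011, §1] -/
theorem scaleAct_mem_clusterSet {g : ConformalRectangle → ℝ} (hg : g ∈ clusterSet) (s : ℝ) :
    scaleAct s g ∈ clusterSet := by
  have h1 : MapClusterPt (scaleAct s g) (nhdsWithin (0 : ℝ) (Set.Ioi 0))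
      (scaleAct s ∘ fun (δ : ℝ) (R : ConformalRectangle) => bondDomainCrossingProb R δ) :=
    hg.continuousAt_comp (continuous_scaleAct s).continuousAt
  have h2 : (scaleAct s ∘ fun (δ : ℝ) (R : ConformalRectangle) => bondDomainCrossingProb R δ) =
      (fun (δ : ℝ) (R : ConformalRectangle) => bondDomainCrossingProb R δ) ∘
        fun δ : ℝ => Real.exp (-s) * δ := by
    funext δ R
    exact bondDomainCrossingProb_map_dilation R s δ
  rw [h2] at h1
  have hc : 0 < Real.exp (-s) := Real.exp_pos _
  have ht : Tendsto (fun δ : ℝ => Real.exp (-s) * δ) (nhdsWithin (0 : ℝ) (Set.Ioi 0))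
      (nhdsWithin (0 : ℝ) (Set.Ioi 0)) := by
    refine tendsto_nhdsWithin_of_tendsto_nhds_of_eventually_within _ ?_ ?_
    · have : Tendsto (fun δ : ℝ => Real.exp (-s) * δ) (𝓝 0) (𝓝 (Real.exp (-s) * 0)) :=
        (continuous_const.mul continuous_id).tendsto 0
      rw [mul_zero] at this
      exact this.mono_left nhdsWithin_le_nhds
    · filter_upwards [self_mem_nhdsWithin] with δ hδ
      exact mul_pos hc hδ
  exact MapClusterPt.of_comp ht h1

/-! ### Equicontinuity of cluster points along dilations -/

/-- **Equicontinuity along dilations** (from `scaleContinuity` and exact covariance): for every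
conformal rectangle `R` and `ε > 0` there is `η > 0` such that EVERY cluster point `g ∈ Λ'`
satisfies `|g (e^u • R) - g R| ≤ ε` whenever `|u| < η`. [cite: SchrammSmirnov2011, §1] -/
theorem clusterSet_equicontinuous (R : ConformalRectangle) {ε : ℝ} (hε : 0 < ε) :
    ∃ η > (0 : ℝ), ∀ g ∈ clusterSet, ∀ u : ℝ, |u| < η → |g (R.map (dilation u)) - g R| ≤ ε := by
  obtain ⟨θ, hθ, δ₀, hδ₀, H⟩ :=
    Summit.CriticalPhenomena.CardyFormulaZ2.Theorems.ClusterSetConnected.scaleContinuity R ε hε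
  refine ⟨Real.log (1 + θ), Real.log_pos (by linarith), fun g hg u hu => ?_⟩
  -- `(g (e^u • R), g R)` is a cluster value of `(p_R(e^{-u} δ), p_R(δ))`
  set ev : (ConformalRectangle → ℝ) → ℝ × ℝ := fun h => (h (R.map (dilation u)), h R) with hev
  have hevc : Continuous ev :=
    (continuous_apply (R.map (dilation u))).prodMk (continuous_apply R)
  have h1 : MapClusterPt (ev g) (nhdsWithin (0 : ℝ) (Set.Ioi 0))
      (ev ∘ fun (δ : ℝ) (R : ConformalRectangle) => bondDomainCrossingProb R δ) :=
    hg.continuousAt_comp hevc.continuousAt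
  have h2 : (ev ∘ fun (δ : ℝ) (R : ConformalRectangle) => bondDomainCrossingProb R δ) =
      fun δ : ℝ => (bondDomainCrossingProb R (Real.exp (-u) * δ), bondDomainCrossingProb R δ) := by
    funext δ
    simp only [hev, Function.comp_apply, bondDomainCrossingProb_map_dilation]
  rw [h2] at h1
  -- eventually the pair lies in the closed set `{(a, b) | |a - b| ≤ ε}`
  have hexpu : Real.exp |u| < 1 + θ := by
    calc Real.exp |u| < Real.exp (Real.log (1 + θ)) := Real.exp_lt_exp.2 hu
      _ = 1 + θ := Real.exp_log (by linarith)
  have hD : IsClosed {q : ℝ × ℝ | |q.1 - q.2| ≤ ε} :=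
    isClosed_le (continuous_abs.comp (continuous_fst.sub continuous_snd)) continuous_const
  have hev_mem : ∀ᶠ δ in nhdsWithin (0 : ℝ) (Set.Ioi 0),
      (bondDomainCrossingProb R (Real.exp (-u) * δ), bondDomainCrossingProb R δ) ∈
        {q : ℝ × ℝ | |q.1 - q.2| ≤ ε} := by
    have hsmall : Set.Ioo 0 (δ₀ * Real.exp (-|u|)) ∈ nhdsWithin (0 : ℝ) (Set.Ioi 0) :=
      Ioo_mem_nhdsGT (mul_pos hδ₀ (Real.exp_pos _))
    filter_upwards [hsmall] with δ hδ
    have hδpos : 0 < δ := hδ.1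
    have hδlt : δ < δ₀ * Real.exp (-|u|) := hδ.2
    have hele1 : Real.exp (-|u|) ≤ 1 := by
      rw [Real.exp_le_one_iff]; exact neg_nonpos.2 (abs_nonneg u)
    have hδδ₀ : δ < δ₀ := by
      calc δ < δ₀ * Real.exp (-|u|) := hδlt
        _ ≤ δ₀ * 1 := by gcongr
        _ = δ₀ := mul_one _
    have hcpos : 0 < Real.exp (-u) := Real.exp_pos _
    show |bondDomainCrossingProb R (Real.exp (-u) * δ) - bondDomainCrossingProb R δ| ≤ ε
    rcases le_or_gt 0 u with hu0 | hu0
    · -- `e^{-u} δ ≤ δ`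
      have habs : |u| = u := abs_of_nonneg hu0
      have hle : Real.exp (-u) * δ ≤ δ := by
        have : Real.exp (-u) ≤ 1 := by rw [Real.exp_le_one_iff]; linarith
        nlinarith
      have hratio : δ ≤ (1 + θ) * (Real.exp (-u) * δ) := by
        have h1' : Real.exp u < 1 + θ := by rw [habs] at hexpu; exact hexpu
        have : δ = Real.exp u * (Real.exp (-u) * δ) := by
          rw [← mul_assoc, ← Real.exp_add, add_neg_cancel, Real.exp_zero, one_mul]
        have hX : 0 < Real.exp (-u) * δ := mul_pos hcpos hδpos
        calc δ = Real.exp u * (Real.exp (-u) * δ) := this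
          _ ≤ (1 + θ) * (Real.exp (-u) * δ) := mul_le_mul_of_nonneg_right h1'.le hX.le
      have key := H (Real.exp (-u) * δ) δ (mul_pos hcpos hδpos) hle hδδ₀ hratio
      rw [abs_sub_comm]
      exact key.le
    · -- `δ < e^{-u} δ`
      have habs : |u| = -u := abs_of_neg hu0
      have hle : δ ≤ Real.exp (-u) * δ := by
        have : 1 ≤ Real.exp (-u) := by rw [Real.one_le_exp_iff]; linarith
        nlinarith
      have hlt : Real.exp (-u) * δ < δ₀ := by
        rw [habs] at hδlt
        calc Real.exp (-u) * δ < Real.exp (-u) * (δ₀ * Real.exp (-(-u))) := by gcongr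
          _ = δ₀ := by rw [neg_neg, mul_comm, mul_assoc, ← Real.exp_add, add_neg_cancel,
                Real.exp_zero, mul_one]
      have hratio : Real.exp (-u) * δ ≤ (1 + θ) * δ := by
        have h1' : Real.exp (-u) < 1 + θ := by rw [habs] at hexpu; exact hexpu
        nlinarith
      have key := H δ (Real.exp (-u) * δ) hδpos hle hlt hratio
      exact key.le
  have hle : Filter.map (fun δ : ℝ =>
      (bondDomainCrossingProb R (Real.exp (-u) * δ), bondDomainCrossingProb R δ))
        (nhdsWithin (0 : ℝ) (Set.Ioi 0)) ≤ 𝓟 {q : ℝ × ℝ | |q.1 - q.2| ≤ ε} := by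
    rw [Filter.le_principal_iff, Filter.mem_map]
    exact hev_mem
  have h3 : ClusterPt (ev g) (𝓟 {q : ℝ × ℝ | |q.1 - q.2| ≤ ε}) := ClusterPt.mono h1 hle
  rw [← mem_closure_iff_clusterPt, hD.closure_eq] at h3
  exact h3

/-! ### The flow -/

/-- The scale action restricted to `Λ'`, as a map `ℝ → Λ' → Λ'`. [folklore] -/
def scaleActOn (s : ℝ) (g : ↥clusterSet) : ↥clusterSet :=
  ⟨scaleAct s (g : ConformalRectangle → ℝ), scaleAct_mem_clusterSet g.2 s⟩

/-- Coordinates of the restricted action. [folklore] -/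
@[simp] theorem coe_scaleActOn (s : ℝ) (g : ↥clusterSet) :
    ((scaleActOn s g : ↥clusterSet) : ConformalRectangle → ℝ) = scaleAct s g := rfl

/-- **Joint continuity** of `(s, g) ↦ scaleAct s g` on `ℝ × Λ'`. [cite: SchrammSmirnov2011, §1] -/
theorem continuous_scaleActOn : Continuous (Function.uncurry scaleActOn) := by
  refine continuous_induced_rng.2 ?_
  refine continuous_pi fun R => ?_
  -- the coordinate `R` : `(s, g) ↦ g (R.map (dilation s))`
  refine continuous_iff_continuousAt.2 fun z₀ => ?_
  obtain ⟨s₀, g₀⟩ := z₀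
  rw [ContinuousAt, Metric.tendsto_nhds]
  intro ε hε
  -- equicontinuity at the rectangle `R.map (dilation s₀)`
  obtain ⟨η, hη, hequi⟩ := clusterSet_equicontinuous (R.map (dilation s₀)) (half_pos hε)
  -- nearby times
  have hs : ∀ᶠ s in 𝓝 s₀, |s - s₀| < η := by
    have : Set.Ioo (s₀ - η) (s₀ + η) ∈ 𝓝 s₀ := Ioo_mem_nhds (by linarith) (by linarith)
    filter_upwards [this] with s hs
    rw [abs_lt]; constructor <;> linarith [hs.1, hs.2]
  -- nearby cluster points, at the one coordinate `R.map (dilation s₀)`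
  have hg : ∀ᶠ g : ↥clusterSet in 𝓝 g₀, dist ((g : ConformalRectangle → ℝ) (R.map (dilation s₀)))
      ((g₀ : ConformalRectangle → ℝ) (R.map (dilation s₀))) < ε / 2 := by
    have hc : Continuous fun g : ↥clusterSet => (g : ConformalRectangle → ℝ) (R.map (dilation s₀)) :=
      (continuous_apply (R.map (dilation s₀))).comp continuous_subtype_val
    exact Metric.tendsto_nhds.1 (hc.tendsto g₀) (ε / 2) (half_pos hε)
  have hprod := hs.prod_nhds hg
  filter_upwards [hprod] with z hz
  obtain ⟨hz1, hz2⟩ := hz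
  show dist (scaleAct z.1 (z.2 : ConformalRectangle → ℝ) R) (scaleAct s₀ (g₀ : ConformalRectangle → ℝ) R) < ε
  simp only [scaleAct]
  -- `R.map (dilation z.1) = (R.map (dilation s₀)).map (dilation (z.1 - s₀))`
  have hR : R.map (dilation z.1) = (R.map (dilation s₀)).map (dilation (z.1 - s₀)) := by
    rw [map_dilation_map_dilation, sub_add_cancel]
  rw [hR]
  have h1 := hequi (z.2 : ConformalRectangle → ℝ) z.2.2 (z.1 - s₀) hz1
  rw [Real.dist_eq] at hz2 ⊢
  calc |(z.2 : ConformalRectangle → ℝ) ((R.map (dilation s₀)).map (dilation (z.1 - s₀))) -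
        (g₀ : ConformalRectangle → ℝ) (R.map (dilation s₀))|
      ≤ |(z.2 : ConformalRectangle → ℝ) ((R.map (dilation s₀)).map (dilation (z.1 - s₀))) -
          (z.2 : ConformalRectangle → ℝ) (R.map (dilation s₀))| +
        |(z.2 : ConformalRectangle → ℝ) (R.map (dilation s₀)) -
          (g₀ : ConformalRectangle → ℝ) (R.map (dilation s₀))| := abs_sub_le _ _ _
    _ < ε / 2 + ε / 2 := add_lt_add_of_le_of_lt h1 hz2
    _ = ε := add_halves ε

/-- The dilation flow on `Λ'`. [cite: SchrammSmirnov2011, §1] -/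
def dilationFlow : Flow ℝ ↥clusterSet where
  toFun := scaleActOn
  cont' := continuous_scaleActOn
  map_add' s t g := Subtype.ext (by
    simp only [coe_scaleActOn]
    exact scaleAct_add s t _)
  map_zero' g := Subtype.ext (by
    simp only [coe_scaleActOn]
    exact scaleAct_zero _)

/-- **Stub A** (registered stub `stub_dilationFlow` of line `dilation-dynamics`, verbatim): the
scale action restricts to a jointly continuous real flow on the cluster set, acting in
coordinates by `(Φ s g) R = g (R.map (dilation s))`. [cite: SchrammSmirnov2011, §1] -/
theorem stub_dilationFlow :
    ∃ Φ : Flow ℝ ↥clusterSet, ∀ (s : ℝ) (g : ↥clusterSet) (R : ConformalRectangle),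
      (Φ s g : ConformalRectangle → ℝ) R = (g : ConformalRectangle → ℝ) (R.map (dilation s)) :=
  ⟨dilationFlow, fun _ _ _ => rfl⟩

/-! ## §B The fixed-point criterion of topological dynamics -/

section General

variable {X : Type*} [TopologicalSpace X]

/-- The set of points on the "exit set" `N ∩ closure Nᶜ` whose backward orbit stays in `N`
during `[-m, 0]`. [folklore] -/
def trapSet (Φ : Flow ℝ X) (N : Set X) (m : ℝ) : Set X :=
  (N ∩ closure Nᶜ) ∩ {x | ∀ s ∈ Icc (-m) 0, Φ s x ∈ N}

/-- `trapSet` shrinks as the trapping time grows. [folklore] -/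
theorem trapSet_antitone (Φ : Flow ℝ X) (N : Set X) : Antitone (trapSet Φ N) := by
  intro m m' hmm' x hx
  exact ⟨hx.1, fun s hs => hx.2 s ⟨by linarith [hs.1], hs.2⟩⟩

/-- `trapSet` is closed when `N` is. [folklore] -/
theorem isClosed_trapSet (Φ : Flow ℝ X) {N : Set X} (hN : IsClosed N) (m : ℝ) :
    IsClosed (trapSet Φ N m) := by
  refine (hN.inter isClosed_closure).inter ?_
  have h : {x : X | ∀ s ∈ Icc (-m) 0, Φ s x ∈ N} = ⋂ s ∈ Icc (-m) (0 : ℝ), (Φ.toFun s) ⁻¹' N := by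
    ext x
    simp only [mem_setOf_eq, mem_iInter, mem_preimage]
  rw [h]
  exact isClosed_biInter fun s _ => hN.preimage (Φ.continuous_toFun s)

/-- **Exit lemma.** If the forward orbit of `y` stays in the closed set `N` during `[0, m]` but
leaves `N` at some time `T ≥ 0`, then the last exit point before leaving lies on `N ∩ closure Nᶜ`
and its backward orbit stays in `N` during `[-m, 0]`. [folklore] -/
theorem trapSet_nonempty_of_exit (Φ : Flow ℝ X) {N : Set X} (hN : IsClosed N) {y : X} {m : ℝ}
    (hm : 0 ≤ m) (htrap : ∀ t ∈ Icc 0 m, Φ t y ∈ N) {T : ℝ} (hT : 0 ≤ T) (hexit : Φ T y ∉ N) :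
    (trapSet Φ N m).Nonempty := by
  set S : Set ℝ := {s | 0 ≤ s ∧ ∀ t ∈ Icc 0 s, Φ t y ∈ N} with hS
  have hmS : m ∈ S := ⟨hm, htrap⟩
  have hSne : S.Nonempty := ⟨m, hmS⟩
  have hbdd : BddAbove S := by
    refine ⟨T, fun s hs => ?_⟩
    by_contra h
    push Not at h
    exact hexit (hs.2 T ⟨hT, h.le⟩)
  set σ : ℝ := sSup S with hσ
  have hmσ : m ≤ σ := le_csSup hbdd hmS
  have hσ0 : 0 ≤ σ := hm.trans hmσ
  have hcont : Continuous fun t : ℝ => Φ t y := Φ.continuous continuous_id continuous_const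
  -- the orbit stays in `N` during `[0, σ)`
  have htrap' : ∀ t, 0 ≤ t → t < σ → Φ t y ∈ N := by
    intro t ht0 htσ
    obtain ⟨s, hs, hts⟩ := exists_lt_of_lt_csSup hSne htσ
    exact hs.2 t ⟨ht0, hts.le⟩
  -- and at `σ` (closedness)
  have hσN : Φ σ y ∈ N := by
    rcases hσ0.eq_or_lt with h | h
    · have h0 := htrap 0 ⟨le_rfl, hm⟩
      rw [← h]
      exact h0
    · have hlim : Tendsto (fun t => Φ t y) (𝓝[<] σ) (𝓝 (Φ σ y)) :=
        (hcont.tendsto σ).mono_left nhdsWithin_le_nhds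
      refine hN.mem_of_tendsto hlim ?_
      have hIoo : Ioo 0 σ ∈ 𝓝[<] σ := Ioo_mem_nhdsLT h
      filter_upwards [hIoo] with t ht
      exact htrap' t ht.1.le ht.2
  have hall : ∀ t ∈ Icc 0 σ, Φ t y ∈ N := fun t ht =>
    (lt_or_eq_of_le ht.2).elim (htrap' t ht.1) fun h => h ▸ hσN
  -- after `σ` the orbit leaves `N` immediately
  have hex : ∀ n : ℕ, ∃ t, σ < t ∧ t < σ + 1 / ((n : ℝ) + 1) ∧ Φ t y ∉ N := by
    intro n
    have hn : (0 : ℝ) < 1 / ((n : ℝ) + 1) := by positivity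
    set s' : ℝ := σ + 1 / ((n : ℝ) + 1) / 2 with hs'
    have hσs' : σ < s' := by rw [hs']; linarith
    have hs'S : s' ∉ S := notMem_of_csSup_lt hσs' hbdd
    have h0s' : 0 ≤ s' := hσ0.trans hσs'.le
    have : ¬ ∀ t ∈ Icc 0 s', Φ t y ∈ N := fun h => hs'S ⟨h0s', h⟩
    push Not at this
    obtain ⟨t, ht, htN⟩ := this
    have hσt : σ < t := by
      by_contra hle
      push Not at hle
      exact htN (hall t ⟨ht.1, hle⟩)
    exact ⟨t, hσt, by rw [hs'] at ht; linarith [ht.2], htN⟩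
  choose t ht using hex
  have htend : Tendsto t atTop (𝓝 σ) := by
    have h1 : Tendsto (fun n : ℕ => σ + 1 / ((n : ℝ) + 1)) atTop (𝓝 σ) := by
      have := tendsto_one_div_add_atTop_nhds_zero_nat.const_add σ
      simpa using this
    refine tendsto_of_tendsto_of_tendsto_of_le_of_le tendsto_const_nhds h1
      (fun n => (ht n).1.le) (fun n => (ht n).2.1.le)
  have hσcl : Φ σ y ∈ closure Nᶜ :=
    mem_closure_of_tendsto ((hcont.tendsto σ).comp htend)
      (Eventually.of_forall fun n => (ht n).2.2)
  -- the exit point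
  refine ⟨Φ σ y, ⟨hσN, hσcl⟩, fun s hs => ?_⟩
  show Φ s (Φ σ y) ∈ N
  rw [← Φ.map_add]
  exact hall (s + σ) ⟨by linarith [hs.1], by linarith [hs.2]⟩

/-- Every cluster point, as `t → -∞`, of an orbit which stays in the closed set `N` for all
`t ≤ 0` lies in `N`. [folklore] -/
theorem mem_of_mapClusterPt_atBot (Φ : Flow ℝ X) {N : Set X} (hN : IsClosed N) {z w : X}
    (hz : ∀ s : ℝ, s ≤ 0 → Φ s z ∈ N) (hw : MapClusterPt w atBot fun t : ℝ => Φ t z) : w ∈ N := by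
  have hle : Filter.map (fun t : ℝ => Φ t z) atBot ≤ 𝓟 N := by
    rw [Filter.le_principal_iff, Filter.mem_map]
    filter_upwards [eventually_le_atBot (0 : ℝ)] with s hs
    exact hz s hs
  have h1 : ClusterPt w (𝓟 N) := ClusterPt.mono hw hle
  rw [← mem_closure_iff_clusterPt, hN.closure_eq] at h1
  exact h1

/-- The α-limit set is invariant: cluster points as `t → -∞` are mapped to cluster points.
[folklore] -/
theorem mapClusterPt_atBot_apply (Φ : Flow ℝ X) {z w : X}
    (hw : MapClusterPt w atBot fun t : ℝ => Φ t z) (t : ℝ) :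
    MapClusterPt (Φ t w) atBot fun s : ℝ => Φ s z := by
  have h1 : MapClusterPt (Φ t w) atBot ((Φ.toFun t) ∘ fun s : ℝ => Φ s z) :=
    hw.continuousAt_comp (Φ.continuous_toFun t).continuousAt
  have h2 : ((Φ.toFun t) ∘ fun s : ℝ => Φ s z) = (fun s : ℝ => Φ s z) ∘ fun s : ℝ => t + s := by
    funext s
    show Φ t (Φ s z) = Φ (t + s) z
    rw [Φ.map_add]
  rw [h2] at h1
  exact MapClusterPt.of_comp (tendsto_atBot_add_const_left atBot t tendsto_id) h1

/-- **Half of the criterion.** With `N` a closed neighbourhood of `p` isolating `p` and with a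
trivial unstable set at `p`, the backward-trapped exit sets `trapSet Φ N m` cannot all be
nonempty. [folklore] -/
theorem false_of_forall_trapSet_nonempty [CompactSpace X] (Φ : Flow ℝ X) {N : Set X} {p : X}
    (hN : IsClosed N) (hNp : N ∈ 𝓝 p) (hiso : ∀ x : X, (∀ t : ℝ, Φ t x ∈ N) → x = p)
    (hun : ∀ x : X, Tendsto (fun t : ℝ => Φ t x) atBot (𝓝 p) → x = p)
    (hall : ∀ m : ℕ, (trapSet Φ N (m : ℝ)).Nonempty) : False := by
  -- a common point of the nested closed nonempty sets
  have hdir : Directed (· ⊇ ·) fun m : ℕ => trapSet Φ N (m : ℝ) := by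
    intro i j
    refine ⟨max i j, ?_, ?_⟩
    · exact trapSet_antitone Φ N (Nat.cast_le.2 (le_max_left i j))
    · exact trapSet_antitone Φ N (Nat.cast_le.2 (le_max_right i j))
  obtain ⟨z, hz⟩ := IsCompact.nonempty_iInter_of_directed_nonempty_isCompact_isClosed
    (fun m : ℕ => trapSet Φ N (m : ℝ)) hdir hall
    (fun m => (isClosed_trapSet Φ hN _).isCompact) (fun m => isClosed_trapSet Φ hN _)
  rw [mem_iInter] at hz
  have hzF : z ∈ N ∩ closure Nᶜ := (hz 0).1
  have hzback : ∀ s : ℝ, s ≤ 0 → Φ s z ∈ N := by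
    intro s hs
    have h := (hz ⌈-s⌉₊).2 s ⟨?_, hs⟩
    · exact h
    · have := Nat.le_ceil (-s)
      linarith
  -- every α-limit point of `z` has its whole orbit in `N`, hence is `p`
  have huniq : ∀ w : X, MapClusterPt w atBot (fun t : ℝ => Φ t z) → w = p := by
    intro w hw
    exact hiso w fun t => mem_of_mapClusterPt_atBot Φ hN hzback (mapClusterPt_atBot_apply Φ hw t)
  -- so the backward orbit converges to `p`
  have htend : Tendsto (fun t : ℝ => Φ t z) atBot (𝓝 p) :=
    isCompact_univ.tendsto_nhds_of_unique_mapClusterPt (Eventually.of_forall fun _ => mem_univ _)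
      fun w _ hw => huniq w hw
  have hzp : z = p := hun z htend
  -- but `z` lies on the exit set, which misses `p`
  have hp : p ∈ interior N := mem_interior_iff_mem_nhds.2 hNp
  have hz2 : z ∈ closure Nᶜ := hzF.2
  rw [closure_compl, hzp] at hz2
  exact hz2 hp

end General

/-- **The fixed-point criterion** (registered stub `stub_fixedPointCriterion` of line
`dilation-dynamics`, verbatim): in a compact connected Hausdorff space with a continuous real
flow, a fixed point that is an isolated invariant set with trivial unstable and stable sets is
the whole space. [folklore] -/
theorem stub_fixedPointCriterion :
    ∀ (X : Type) [TopologicalSpace X] [CompactSpace X] [T2Space X] [ConnectedSpace X]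
      (Φ : Flow ℝ X) (p : X), (∀ t : ℝ, Φ t p = p) →
      (∃ N ∈ 𝓝 p, ∀ x : X, (∀ t : ℝ, Φ t x ∈ N) → x = p) →
      (∀ x : X, Tendsto (fun t : ℝ => Φ t x) atBot (𝓝 p) → x = p) →
      (∀ x : X, Tendsto (fun t : ℝ => Φ t x) atTop (𝓝 p) → x = p) →
      ∀ x : X, x = p := by
  intro X _ _ _ _ Φ p hfix hiso hun hst
  obtain ⟨N₀, hN₀, hiso₀⟩ := hiso
  obtain ⟨N, hNnhds, hNclosed, hNsub⟩ := exists_mem_nhds_isClosed_subset hN₀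
  have hisoN : ∀ x : X, (∀ t : ℝ, Φ t x ∈ N) → x = p :=
    fun x hx => hiso₀ x fun t => hNsub (hx t)
  by_contra hcon
  push Not at hcon
  obtain ⟨x₀, hx₀⟩ := hcon
  -- `p` is not an isolated point of the connected space `X`
  have hnotiso : ∀ U ∈ 𝓝 p, ∃ y ∈ U, y ≠ p := by
    intro U hU
    by_contra h
    push Not at h
    have hsing : ({p} : Set X) ∈ 𝓝 p := mem_of_superset hU fun y hy => h y hy
    have hopen : IsOpen ({p} : Set X) :=
      isOpen_iff_mem_nhds.2 fun y hy => by rw [mem_singleton_iff.1 hy]; exact hsing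
    have hclopen : IsClopen ({p} : Set X) := ⟨isClosed_singleton, hopen⟩
    rcases isClopen_iff.1 hclopen with h0 | h1
    · exact (singleton_ne_empty p) h0
    · exact hx₀ (by rw [← mem_singleton_iff, h1]; exact mem_univ _)
  -- for every `m`, an exit point for `Φ` or for the reversed flow
  have hkey : ∀ m : ℕ,
      (trapSet Φ N (m : ℝ)).Nonempty ∨ (trapSet Φ.reverse N (m : ℝ)).Nonempty := by
    intro m
    have hB : {x : X | ∀ t ∈ Icc (-(m : ℝ)) m, Φ t x ∈ N} ∈ 𝓝 p := by
      have hK : IsCompact (Icc (-(m : ℝ)) m) := isCompact_Icc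
      have hP : ∀ t ∈ Icc (-(m : ℝ)) m,
          ∀ᶠ z : X × ℝ in 𝓝 (p, t), Φ z.2 z.1 ∈ interior N := by
        intro t _
        have hc : Continuous fun z : X × ℝ => Φ z.2 z.1 :=
          Φ.continuous continuous_snd continuous_fst
        have hpt : Φ t p ∈ interior N := by
          rw [hfix]
          exact mem_interior_iff_mem_nhds.2 hNnhds
        exact hc.continuousAt.eventually_mem (isOpen_interior.mem_nhds hpt)
      have h := hK.eventually_forall_of_forall_eventually
        (P := fun (x : X) (t : ℝ) => Φ t x ∈ interior N) hP
      exact h.mono fun x hx t ht => interior_subset (hx t ht)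
    obtain ⟨y, hy, hyp⟩ := hnotiso _ hB
    have hleave : ∃ T : ℝ, Φ T y ∉ N := by
      by_contra h
      push Not at h
      exact hyp (hisoN y h)
    obtain ⟨T, hT⟩ := hleave
    rcases le_or_gt 0 T with hT0 | hT0
    · left
      exact trapSet_nonempty_of_exit Φ hNclosed (Nat.cast_nonneg m)
        (fun t ht => hy t ⟨by linarith [ht.1], ht.2⟩) hT0 hT
    · right
      refine trapSet_nonempty_of_exit Φ.reverse hNclosed (y := y) (Nat.cast_nonneg m)
        (fun t ht => ?_) (neg_nonneg.2 hT0.le) ?_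
      · show Φ (-t) y ∈ N
        exact hy (-t) ⟨by linarith [ht.2], by linarith [ht.1]⟩
      · show Φ (-(-T)) y ∉ N
        rw [neg_neg]
        exact hT
  -- pigeonhole: one of the two nested families is nonempty for every `m`
  have hdich : (∀ m : ℕ, (trapSet Φ N (m : ℝ)).Nonempty) ∨
      (∀ m : ℕ, (trapSet Φ.reverse N (m : ℝ)).Nonempty) := by
    by_contra h
    push Not at h
    obtain ⟨⟨m₁, hm₁⟩, ⟨m₂, hm₂⟩⟩ := h
    rcases hkey (max m₁ m₂) with h1 | h2
    · have hsub := trapSet_antitone Φ N (Nat.cast_le.2 (le_max_left m₁ m₂) :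
        ((m₁ : ℕ) : ℝ) ≤ ((max m₁ m₂ : ℕ) : ℝ))
      obtain ⟨z, hz⟩ := h1
      have : z ∈ trapSet Φ N (m₁ : ℝ) := hsub hz
      rw [hm₁] at this
      exact this
    · have hsub := trapSet_antitone Φ.reverse N (Nat.cast_le.2 (le_max_right m₁ m₂) :
        ((m₂ : ℕ) : ℝ) ≤ ((max m₁ m₂ : ℕ) : ℝ))
      obtain ⟨z, hz⟩ := h2
      have : z ∈ trapSet Φ.reverse N (m₂ : ℝ) := hsub hz
      rw [hm₂] at this
      exact this
  rcases hdich with hall | hall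
  · exact false_of_forall_trapSet_nonempty Φ hNclosed hNnhds hisoN hun hall
  · refine false_of_forall_trapSet_nonempty Φ.reverse hNclosed hNnhds (fun x hx => ?_)
      (fun x hx => ?_) hall
    · exact hisoN x fun t => by simpa using hx (-t)
    · apply hst x
      have h : (fun t : ℝ => Φ t x) = (fun t : ℝ => Φ.reverse t x) ∘ Neg.neg := by
        funext t
        simp
      rw [h]
      exact hx.comp tendsto_neg_atTop_atBot

/-! ## §C The split and its glue -/

/-- A **Cardy shadow**: `g R = F(crossRatio x)` for every uniformizing datum `(φ, x)` of `R`
(the hypothesis of the crux, verbatim). [cite: Smirnov2001, Thm 1] -/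
def IsCardyShadow (g : ConformalRectangle → ℝ) : Prop :=
  ∀ (R : ConformalRectangle) (φ : ConformalEquiv UpperHalfPlane.upperHalfPlaneSet R.carrier)
    (x : Fin 4 → ℝ), R.IsUniformizing φ x → g R = cardyFunction (crossRatio x)

/-- **Cardy shadows are fixed points of the scale action** (`IsUniformizing.image_data`).
[cite: Smirnov2001, Thm 1] -/
theorem isCardyShadow_scaleAct {g : ConformalRectangle → ℝ} (hg : IsCardyShadow g) (s : ℝ) :
    scaleAct s g = g := by
  funext R
  obtain ⟨φ, x, hφ⟩ := MarkedDomain.exists_isUniformizing_holds R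
  have hd : DifferentiableOn ℂ (fun z : ℂ => ((Real.exp s : ℝ) : ℂ) * z) R.carrier :=
    (differentiable_id.const_mul _).differentiableOn
  have hi : Set.InjOn (fun z : ℂ => ((Real.exp s : ℝ) : ℂ) * z) R.carrier :=
    fun _ _ _ _ hxy => mul_left_cancel₀ (exp_ofReal_ne_zero s) hxy
  have hc : ContinuousOn (fun z : ℂ => ((Real.exp s : ℝ) : ℂ) * z) (closure R.carrier) :=
    (continuous_const.mul continuous_id).continuousOn
  have hS : (R.map (dilation s)).carrier = (fun z : ℂ => ((Real.exp s : ℝ) : ℂ) * z) '' R.carrier := by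
    rw [MarkedDomain.carrier_map, coe_dilation]
  have hpt : ∀ i, (R.map (dilation s)).pt i = (fun z : ℂ => ((Real.exp s : ℝ) : ℂ) * z) (R.pt i) :=
    fun i => by rw [MarkedDomain.pt_map, dilation_apply]
  have hφ' := hφ.image_data hd hi hc hS hpt
  show g (R.map (dilation s)) = g R
  rw [hg _ _ _ hφ', hg _ _ _ hφ]

/-- `Λ'` lies in the Tychonoff cube `[0,1]^ConformalRectangle`. [folklore] -/
theorem clusterSet_subset_cube :
    clusterSet ⊆ Set.pi Set.univ (fun _ : ConformalRectangle => Set.Icc (0 : ℝ) 1) := by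
  intro g hg
  have hK : IsClosed (Set.pi Set.univ (fun _ : ConformalRectangle => Set.Icc (0 : ℝ) 1)) :=
    isClosed_set_pi fun _ _ => isClosed_Icc
  have hle : Filter.map (fun (δ : ℝ) (R : ConformalRectangle) => bondDomainCrossingProb R δ)
      (nhdsWithin (0 : ℝ) (Set.Ioi 0)) ≤
      𝓟 (Set.pi Set.univ (fun _ : ConformalRectangle => Set.Icc (0 : ℝ) 1)) := by
    rw [Filter.le_principal_iff, Filter.mem_map]
    exact Filter.Eventually.of_forall fun δ => Set.mem_univ_pi.2 fun R =>
      bondDomainCrossingProb_mem_Icc R δ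
  have h1 : ClusterPt g (𝓟 (Set.pi Set.univ (fun _ : ConformalRectangle => Set.Icc (0 : ℝ) 1))) :=
    ClusterPt.mono hg hle
  rw [← mem_closure_iff_clusterPt, hK.closure_eq] at h1
  exact h1

/-- `Λ'` is closed (cluster sets of filters are closed). [folklore] -/
theorem isClosed_clusterSet : IsClosed clusterSet :=
  isClosed_setOf_clusterPt

/-- `Λ'` is compact (closed in the compact Tychonoff cube). [folklore] -/
theorem isCompact_clusterSet : IsCompact clusterSet :=
  (isCompact_univ_pi fun _ => isCompact_Icc).of_isClosed_subset isClosed_clusterSet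
    clusterSet_subset_cube

/-- `Λ'` is preconnected — the PROVED crux `ClusterSetConnected` (stmt-CriticalPhenomena-5769).
[cite: Hale2010, Lemma 3.1.1] -/
theorem isPreconnected_clusterSet : IsPreconnected clusterSet :=
  Summit.CriticalPhenomena.CardyFormulaZ2.Theorems.ClusterSetConnected.clusterSetConnected_anchored

/-- SUB-CRUX 1 (`children.json` decl `CardyIsolatedInvariant`, stated over tree declarations only):
**the Cardy shadow is an isolated invariant set of the RG flow on `Λ'`** — a cluster point whose
WHOLE dilation orbit stays in some product-neighbourhood of a Cardy shadow `g ∈ Λ'` is `g`.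
[cite: SchrammSmirnov2011, §1] -/
def CardyIsolatedInvariant : Prop :=
  ∀ g : Literature.Probability.RandomPlanarGeometry.ConformalRectangle → ℝ, (∀ (R : Literature.Probability.RandomPlanarGeometry.ConformalRectangle) (φ : Literature.Probability.RandomPlanarGeometry.ConformalEquiv UpperHalfPlane.upperHalfPlaneSet R.carrier) (x : Fin 4 → ℝ), R.IsUniformizing φ x → g R = Literature.Probability.RandomPlanarGeometry.cardyFunction (Literature.Probability.RandomPlanarGeometry.crossRatio x)) → MapClusterPt g (nhdsWithin (0 : ℝ) (Set.Ioi 0)) (fun (δ : ℝ) (R : Literature.Probability.RandomPlanarGeometry.ConformalRectangle) => Literature.Probability.Percolation.bondDomainCrossingProb R δ) → ∃ N ∈ nhds g, ∀ g' : Literature.Probability.RandomPlanarGeometry.ConformalRectangle → ℝ, MapClusterPt g' (nhdsWithin (0 : ℝ) (Set.Ioi 0)) (fun (δ : ℝ) (R : Literature.Probability.RandomPlanarGeometry.ConformalRectangle) => Literature.Probability.Percolation.bondDomainCrossingProb R δ) → (∀ s : ℝ, (fun R : Literature.Probability.RandomPlanarGeometry.ConformalRectangle => g' (R.map (Homeomorph.mulLeft₀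 ((Real.exp s : ℝ) : ℂ) (Complex.ofReal_ne_zero.2 (Real.exp_pos s).ne')))) ∈ N) → g' = g

/-- SUB-CRUX 2 (`children.json` decl `CardyUnstableTrivial`): **trivial unstable set** — a cluster
point whose dilates converge to a Cardy shadow `g` as the log-scale `s → -∞` (Cardy in the
ultraviolet) is `g`. [cite: GarbanPeteSchramm2018, Cor. 86] -/
def CardyUnstableTrivial : Prop :=
  ∀ g : Literature.Probability.RandomPlanarGeometry.ConformalRectangle → ℝ, (∀ (R : Literature.Probability.RandomPlanarGeometry.ConformalRectangle) (φ : Literature.Probability.RandomPlanarGeometry.ConformalEquiv UpperHalfPlane.upperHalfPlaneSet R.carrier) (x : Fin 4 → ℝ), R.IsUniformizing φ x → g R = Literature.Probability.RandomPlanarGeometry.cardyFunction (Literature.Probability.RandomPlanarGeometry.crossRatio x)) → ∀ g' : Literature.Probability.RandomPlanarGeometry.ConformalRectangle → ℝ, MapClusterPt g' (nhdsWithin (0 : ℝ) (Set.Ioi 0)) (fun (δ : ℝ) (R : Literature.Probability.RandomPlanarGeometry.ConformalRectangle) => Literature.Probability.Percolation.bondDomainCrossingProb R δ) → Filter.Tendsto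 (fun (s : ℝ) (R : Literature.Probability.RandomPlanarGeometry.ConformalRectangle) => g' (R.map (Homeomorph.mulLeft₀ ((Real.exp s : ℝ) : ℂ) (Complex.ofReal_ne_zero.2 (Real.exp_pos s).ne')))) Filter.atBot (nhds g) → g' = g

/-- SUB-CRUX 3 (`children.json` decl `CardyStableTrivial`): **trivial stable set** — a cluster
point whose dilates converge to a Cardy shadow `g` as the log-scale `s → +∞` (Cardy in the
infrared) is `g`. [cite: SchrammSmirnov2011, §1] -/
def CardyStableTrivial : Prop :=
  ∀ g : Literature.Probability.RandomPlanarGeometry.ConformalRectangle → ℝ, (∀ (R : Literature.Probability.RandomPlanarGeometry.ConformalRectangle) (φ : Literature.Probability.RandomPlanarGeometry.ConformalEquiv UpperHalfPlane.upperHalfPlaneSet R.carrier) (x : Fin 4 → ℝ), R.IsUniformizing φ x → g R = Literature.Probability.RandomPlanarGeometry.cardyFunction (Literature.Probability.RandomPlanarGeometry.crossRatio x)) → ∀ g' : Literature.Probability.RandomPlanarGeometry.ConformalRectangle → ℝ, MapClusterPt g' (nhdsWithin (0 : ℝ) (Set.Ioi 0)) (fun (δ : ℝ) (R : Literature.Probability.RandomPlanarGeometry.ConformalRectangle)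 => Literature.Probability.Percolation.bondDomainCrossingProb R δ) → Filter.Tendsto (fun (s : ℝ) (R : Literature.Probability.RandomPlanarGeometry.ConformalRectangle) => g' (R.map (Homeomorph.mulLeft₀ ((Real.exp s : ℝ) : ℂ) (Complex.ofReal_ne_zero.2 (Real.exp_pos s).ne')))) Filter.atTop (nhds g) → g' = g

/-- The glue for the literal crux text (shared by both routes). [folklore] -/
theorem isolated_of_subs (hC : CardyIsolatedInvariant) (hD : CardyUnstableTrivial)
    (hE : CardyStableTrivial) :
    ∀ g : ConformalRectangle → ℝ,
      (∀ (R : ConformalRectangle)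
        (φ : ConformalEquiv UpperHalfPlane.upperHalfPlaneSet R.carrier) (x : Fin 4 → ℝ),
        R.IsUniformizing φ x → g R = cardyFunction (crossRatio x)) →
      MapClusterPt g (nhdsWithin (0 : ℝ) (Set.Ioi 0))
        (fun (δ : ℝ) (R : ConformalRectangle) => Literature.Probability.Percolation.bondDomainCrossingProb R δ) →
      ∃ U ∈ nhds g, ∀ g' ∈ U,
        MapClusterPt g' (nhdsWithin (0 : ℝ) (Set.Ioi 0))
          (fun (δ : ℝ) (R : ConformalRectangle) => Literature.Probability.Percolation.bondDomainCrossingProb R δ) → g' = g := by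
  -- read the sub-cruxes through the local vocabulary (definitional)
  have hC' : ∀ g : ConformalRectangle → ℝ, IsCardyShadow g → g ∈ clusterSet →
      ∃ N ∈ 𝓝 g, ∀ g' ∈ clusterSet, (∀ s : ℝ, scaleAct s g' ∈ N) → g' = g :=
    fun g hg hgΛ => hC g hg hgΛ
  have hD' : ∀ g : ConformalRectangle → ℝ, IsCardyShadow g → ∀ g' ∈ clusterSet,
      Tendsto (fun s : ℝ => scaleAct s g') atBot (𝓝 g) → g' = g :=
    fun g hg g' hg' h => hD g hg g' hg' h
  have hE' : ∀ g : ConformalRectangle → ℝ, IsCardyShadow g → ∀ g' ∈ clusterSet,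
      Tendsto (fun s : ℝ => scaleAct s g') atTop (𝓝 g) → g' = g :=
    fun g hg g' hg' h => hE g hg g' hg' h
  intro g hshadow hg
  refine ⟨Set.univ, Filter.univ_mem, fun g' _ hg' => ?_⟩
  have hgΛ : g ∈ clusterSet := hg
  have hg'Λ : g' ∈ clusterSet := hg'
  have hsh : IsCardyShadow g := hshadow
  -- `Λ'` as a compact connected Hausdorff space
  haveI : CompactSpace ↥clusterSet := isCompact_iff_compactSpace.1 isCompact_clusterSet
  haveI : ConnectedSpace ↥clusterSet :=
    isConnected_iff_connectedSpace.1 ⟨⟨g, hgΛ⟩, isPreconnected_clusterSet⟩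
  -- the dilation flow (§A) and its Cardy fixed point
  let Φ : Flow ℝ ↥clusterSet := dilationFlow
  have hval : ∀ (t : ℝ) (x : ↥clusterSet),
      ((Φ t x : ↥clusterSet) : ConformalRectangle → ℝ) = scaleAct t (x : ConformalRectangle → ℝ) :=
    fun t x => rfl
  let p : ↥clusterSet := ⟨g, hgΛ⟩
  have hfix : ∀ t : ℝ, Φ t p = p := fun t =>
    Subtype.ext (by rw [hval]; exact isCardyShadow_scaleAct hsh t)
  -- (i) isolated invariant set
  have hiso : ∃ N ∈ 𝓝 p, ∀ x : ↥clusterSet, (∀ t : ℝ, Φ t x ∈ N) → x = p := by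
    obtain ⟨N, hN, hNiso⟩ := hC' g hsh hgΛ
    refine ⟨Subtype.val ⁻¹' N, continuous_subtype_val.continuousAt.preimage_mem_nhds hN,
      fun x hx => Subtype.ext (hNiso x x.2 fun t => ?_)⟩
    have h := hx t
    rw [Set.mem_preimage, hval] at h
    exact h
  -- (ii) trivial unstable set
  have hun : ∀ x : ↥clusterSet, Tendsto (fun t : ℝ => Φ t x) atBot (𝓝 p) → x = p := by
    intro x hx
    refine Subtype.ext (hD' g hsh x x.2 ?_)
    have h := (continuous_subtype_val.tendsto p).comp hx
    have hfun : (Subtype.val ∘ fun t : ℝ => Φ t x) = fun t : ℝ => scaleAct t (x : ConformalRectangle → ℝ) :=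
      funext fun t => hval t x
    rw [hfun] at h
    exact h
  -- (iii) trivial stable set
  have hst : ∀ x : ↥clusterSet, Tendsto (fun t : ℝ => Φ t x) atTop (𝓝 p) → x = p := by
    intro x hx
    refine Subtype.ext (hE' g hsh x x.2 ?_)
    have h := (continuous_subtype_val.tendsto p).comp hx
    have hfun : (Subtype.val ∘ fun t : ℝ => Φ t x) = fun t : ℝ => scaleAct t (x : ConformalRectangle → ℝ) :=
      funext fun t => hval t x
    rw [hfun] at h
    exact h
  -- the criterion (§B): `Λ' = {g}`
  have key := stub_fixedPointCriterion (↥clusterSet) Φ p hfix hiso hun hst ⟨g', hg'Λ⟩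
  exact congrArg Subtype.val key

/-- **Split glue** (strategist decomposition of the crux): the three sub-cruxes imply
`CardyShadowIsolated` BY NAME (route CardyAnchoredRigidity). [folklore] -/
theorem CardyShadowIsolated_of_subs (hC : CardyIsolatedInvariant) (hD : CardyUnstableTrivial)
    (hE : CardyStableTrivial) :
    Summit.CriticalPhenomena.CardyFormulaZ2.Theses.CardyAnchoredRigidity.CardyShadowIsolated :=
  isolated_of_subs hC hD hE

/-- The same glue for the sibling route's decl (route CardyLocalRigidity; shared item
stmt-CriticalPhenomena-5767). [folklore] -/
theorem CardyShadowIsolated_of_subs_local (hC : CardyIsolatedInvariant) (hD : CardyUnstableTrivial)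
    (hE : CardyStableTrivial) :
    Summit.CriticalPhenomena.CardyFormulaZ2.Theses.CardyLocalRigidity.CardyShadowIsolated :=
  isolated_of_subs hC hD hE

end Summit.CriticalPhenomena.CardyFormulaZ2.Theorems.CardyShadowIsolated.DilationDynamics

end
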